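import Mathlib.Analysis.SpecificLimits.Basic
import Mathlib.Order.Northcott
import Mathlib.GroupTheory.OrderOfElement
import Mathlib.Order.Bounds.Basic
import HarnessLib

-- provenance: harness21/H21/H21/Prelude/DiophValNum/CanonicalHeight.lean @ 8ab0aae (interim HEAD d8f2665); M5 mechanical rewrite
/-!
# Néron–Tate canonical heights on an abstract Mordell–Weil group

Trunk: `DiophValNum` (G22), TRUNKS §27 line (2) "canonical height on abelian varieties", as an
*interface* (hypothesis-structure). We work with an abstract additive commutative group `G`
(think `G = A(K)` for an abelian variety `A` over a number field `K`) and a "naive" height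
`h : G → ℝ` (think: the Weil height attached to a symmetric ample divisor). A function
`ĥ : G → ℝ` is a *canonical height for `h`* (`Literature.IsCanonicalHeightFor h ĥ`) if it satisfies the
parallelogram law exactly and differs from `h` by a bounded function; Tate's limit
`Literature.canonicalHeightOf h P = lim h (2ⁿ • P) / 4ⁿ` produces such a function as soon as `h`
satisfies the parallelogram law up to `O(1)` and is even up to `O(1)`.

## Main definitions

* `Literature.canonicalHeightOf h` : Tate's limit construction.
* `Literature.HasApproxParallelogramLaw h` : `h (P + Q) + h (P - Q) = 2 h P + 2 h Q + O(1)`.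
* `Literature.IsCanonicalHeightFor h ĥ` : `ĥ` is a quadratic form (parallelogram law) with `ĥ - h = O(1)`.
* `Literature.neronTatePairing ĥ P Q = (ĥ (P + Q) - ĥ P - ĥ Q) / 2` : the Néron–Tate height pairing.

## Main statements

* uniqueness (`IsCanonicalHeightFor.unique`), Tate's existence theorem
  (`isCanonicalHeightFor_canonicalHeightOf`), vanishing on torsion, nonnegativity, the Northcott
  finiteness property and `ĥ P = 0 ↔ P torsion` under Mathlib's `Northcott h` hypothesis.

## Design notes

* Mathlib has no canonical/Néron–Tate height (grep for `canonicalHeight`, `NeronTate`,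
  `parallelogram_law` on groups: nothing relevant); it *does* have the `Northcott` typeclass
  (`Mathlib/Order/Northcott.lean`) and `IsOfFinAddOrder` (`Mathlib/GroupTheory/OrderOfElement.lean`),
  which we use for the finiteness and torsion hypotheses.
* Normalisation: `|ĥ - h| = O(1)` with **no factor ½**, the same formula as the elliptic-curve
  `canonicalHeight` of trunk `TranscendEllArithS` (G06), so that the glue lemma (item `EllArithGlue`)
  is literal. This file contains no elliptic-curve content.
* `canonicalHeightOf` uses `limUnder`, hence returns a junk value when the limit does not exist;
  all lemmas about it assume hypotheses guaranteeing convergence.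

## References

* M. Hindry, J. Silverman, *Diophantine Geometry: an Introduction*, Theorem B.5.1.
* J. Silverman, *The Arithmetic of Elliptic Curves*, VIII.9, Theorem 9.3.
* J. Tate, letter to Serre (1962); S. Lang, *Fundamentals of Diophantine Geometry*, Ch. 5.
-/

open Filter Topology

namespace Literature.NumberTheory.DiophantineGeometry

variable {G : Type*} [AddCommGroup G]

/-- Tate's limit construction of the canonical height attached to a naive height `h : G → ℝ`:
`canonicalHeightOf h P = lim_{n → ∞} h (2ⁿ • P) / 4ⁿ`. Defined via `limUnder`, so this is a junk
value if the sequence does not converge (it does converge when `h` satisfies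
`HasApproxParallelogramLaw` and is even up to `O(1)`, see `isCanonicalHeightFor_canonicalHeightOf`).
Hindry–Silverman, *Diophantine Geometry*, Theorem B.5.1; Silverman, AEC VIII.9. [folklore] -/
noncomputable def canonicalHeightOf (h : G → ℝ) : G → ℝ :=
  fun P ↦ limUnder atTop (fun n : ℕ ↦ h ((2 ^ n) • P) / 4 ^ n)

/-- A naive height `h : G → ℝ` satisfies the *approximate parallelogram law* if
`h (P + Q) + h (P - Q) = 2 h P + 2 h Q + O(1)` uniformly in `P Q`. For the Weil height of a
symmetric ample divisor on an abelian variety this is a consequence of the theorem of the cube.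
Hindry–Silverman, *Diophantine Geometry*, Theorem B.5.1 (hypothesis); Silverman, AEC VIII.6.2. [folklore] -/
def HasApproxParallelogramLaw (h : G → ℝ) : Prop :=
  ∃ C : ℝ, ∀ P Q : G, |h (P + Q) + h (P - Q) - 2 * h P - 2 * h Q| ≤ C

/-- `IsCanonicalHeightFor h ĥ` says that `ĥ : G → ℝ` is a canonical (Néron–Tate) height for the
naive height `h : G → ℝ`: `ĥ` satisfies the parallelogram law exactly (i.e. is a quadratic form on
`G`) and `ĥ - h` is bounded. Such an `ĥ` is unique (`IsCanonicalHeightFor.unique`) and equals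
Tate's limit (`IsCanonicalHeightFor.eq_canonicalHeightOf`).
Hindry–Silverman, *Diophantine Geometry*, Theorem B.5.1; Silverman, AEC VIII.9.3. [folklore] -/
structure IsCanonicalHeightFor (h ĥ : G → ℝ) : Prop where
  /-- The parallelogram law `ĥ (P + Q) + ĥ (P - Q) = 2 ĥ P + 2 ĥ Q`. -/
  parallelogram_law : ∀ P Q : G, ĥ (P + Q) + ĥ (P - Q) = 2 * ĥ P + 2 * ĥ Q
  /-- `ĥ - h` is bounded. -/
  isBounded_sub : ∃ C : ℝ, ∀ P : G, |ĥ P - h P| ≤ C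

/-- The Néron–Tate height pairing attached to a (canonical) height `ĥ`:
`⟨P, Q⟩ = (ĥ (P + Q) - ĥ P - ĥ Q) / 2`, normalised so that `⟨P, P⟩ = ĥ P`
(`neronTatePairing_self`). Silverman, AEC VIII.9.3; Hindry–Silverman B.5.
Same formula as the elliptic `heightPairing` of trunk `TranscendEllArithS`. [folklore] -/
noncomputable def neronTatePairing (ĥ : G → ℝ) (P Q : G) : ℝ :=
  (ĥ (P + Q) - ĥ P - ĥ Q) / 2

namespace IsCanonicalHeightFor

variable {h ĥ ĥ₁ ĥ₂ : G → ℝ}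

/-- A canonical height vanishes at `0` (put `P = Q = 0` in the parallelogram law).
Silverman, AEC VIII.9.3. [folklore] -/
theorem map_zero (hc : IsCanonicalHeightFor h ĥ) : ĥ 0 = 0 := by
  have := hc.parallelogram_law 0 0
  simp only [add_zero, sub_zero] at this
  linarith

/-- A canonical height is even: `ĥ (-P) = ĥ P` (put `P = 0` in the parallelogram law).
Silverman, AEC VIII.9.3. [folklore] -/
theorem map_neg (hc : IsCanonicalHeightFor h ĥ) (P : G) : ĥ (-P) = ĥ P := by
  have := hc.parallelogram_law 0 P
  simp only [zero_add, zero_sub, hc.map_zero, mul_zero] at this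
  linarith

/-- A canonical height is quadratic: `ĥ (n • P) = n ^ 2 * ĥ P` for `n : ℕ`.
Silverman, AEC VIII.9.3(b); Hindry–Silverman B.5.1. [folklore] -/
theorem map_nsmul (hc : IsCanonicalHeightFor h ĥ) (n : ℕ) (P : G) :
    ĥ (n • P) = (n : ℝ) ^ 2 * ĥ P := by
  induction n using Nat.strong_induction_on with
  | _ n ih =>
    match n with
    | 0 => simp [hc.map_zero]
    | 1 => simp
    | (k + 2) =>
      have h1 := ih (k + 1) (by omega)
      have h0 := ih k (by omega)
      have hpl := hc.parallelogram_law ((k + 1) • P) P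
      have e1 : (k + 1) • P + P = (k + 2) • P := by rw [← succ_nsmul]
      have e2 : (k + 1) • P - P = k • P := by rw [succ_nsmul, add_sub_cancel_right]
      rw [e1, e2, h1, h0] at hpl
      push_cast at hpl ⊢
      linarith

/-- A canonical height is quadratic: `ĥ (n • P) = n ^ 2 * ĥ P` for `n : ℤ`.
Silverman, AEC VIII.9.3(b); Hindry–Silverman B.5.1. [folklore] -/
theorem map_zsmul (hc : IsCanonicalHeightFor h ĥ) (n : ℤ) (P : G) :
    ĥ (n • P) = (n : ℝ) ^ 2 * ĥ P := by
  obtain ⟨m, rfl | rfl⟩ := Int.eq_nat_or_neg n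
  · simp [hc.map_nsmul]
  · simp [hc.map_neg, hc.map_nsmul]

/-- Tate: if `ĥ` is a canonical height for `h` then `h (2ⁿ • P) / 4ⁿ → ĥ P`.
Hindry–Silverman, *Diophantine Geometry*, Theorem B.5.1 (proof); Silverman, AEC VIII.9.1. [folklore] -/
theorem tendsto (hc : IsCanonicalHeightFor h ĥ) (P : G) :
    Tendsto (fun n : ℕ ↦ h ((2 ^ n) • P) / 4 ^ n) atTop (𝓝 (ĥ P)) := by
  obtain ⟨C, hC⟩ := hc.isBounded_sub
  have key : ∀ n : ℕ, |h ((2 ^ n) • P) / 4 ^ n - ĥ P| ≤ C / 4 ^ n := fun n ↦ by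
    have h4 : (0 : ℝ) < 4 ^ n := by positivity
    have hq := hc.map_nsmul (2 ^ n) P
    have : ĥ P = ĥ ((2 ^ n) • P) / 4 ^ n := by
      rw [hq, eq_div_iff h4.ne']
      push_cast
      rw [← pow_mul, mul_comm (ĥ P)]
      congr 1
      rw [show (4 : ℝ) = 2 ^ 2 by norm_num, ← pow_mul, mul_comm]
    rw [this, ← sub_div, abs_div, abs_of_pos h4, div_le_div_iff_of_pos_right h4, abs_sub_comm]
    exact hC _
  have hlim : Tendsto (fun n : ℕ ↦ C / (4 : ℝ) ^ n) atTop (𝓝 0) := by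
    simpa [div_eq_mul_inv] using (tendsto_pow_atTop_nhds_zero_of_lt_one (r := (4 : ℝ)⁻¹)
      (by norm_num) (by norm_num)).const_mul C
  have hlo : Tendsto (fun n : ℕ ↦ ĥ P - C / (4 : ℝ) ^ n) atTop (𝓝 (ĥ P)) := by
    simpa using hlim.const_sub (ĥ P)
  have hhi : Tendsto (fun n : ℕ ↦ ĥ P + C / (4 : ℝ) ^ n) atTop (𝓝 (ĥ P)) := by
    simpa using hlim.const_add (ĥ P)
  refine tendsto_of_tendsto_of_tendsto_of_le_of_le hlo hhi (fun n ↦ ?_) (fun n ↦ ?_)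
  · have := (abs_le.mp (key n)).1; linarith
  · have := (abs_le.mp (key n)).2; linarith

/-- A canonical height for `h` equals Tate's limit `canonicalHeightOf h`.
Hindry–Silverman, *Diophantine Geometry*, Theorem B.5.1. [folklore] -/
theorem eq_canonicalHeightOf (hc : IsCanonicalHeightFor h ĥ) : ĥ = canonicalHeightOf h := by
  funext P
  exact ((hc.tendsto P).limUnder_eq).symm

/-- Uniqueness of the canonical height: two canonical heights for the same naive height agree.
Hindry–Silverman, *Diophantine Geometry*, Theorem B.5.1; Silverman, AEC VIII.9.3. [folklore] -/
theorem unique (h₁ : IsCanonicalHeightFor h ĥ₁) (h₂ : IsCanonicalHeightFor h ĥ₂) : ĥ₁ = ĥ₂ := by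
  rw [h₁.eq_canonicalHeightOf, h₂.eq_canonicalHeightOf]

end IsCanonicalHeightFor

/-- **Tate's existence theorem.** If the naive height `h` satisfies the parallelogram law up to
`O(1)` and is even up to `O(1)`, then Tate's limit `canonicalHeightOf h` is a canonical height for
`h`. Hindry–Silverman, *Diophantine Geometry*, Theorem B.5.1; Silverman, AEC VIII.9.1, VIII.9.3. [cite: HindrySilverman2000, Theorem B.5.1] -/
def isCanonicalHeightFor_canonicalHeightOf : Prop :=
  ∀ {h : G → ℝ} (hh : HasApproxParallelogramLaw h) (hneg : ∃ C : ℝ, ∀ P : G, |h (-P) - h P| ≤ C),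
    IsCanonicalHeightFor h (canonicalHeightOf h)

namespace IsCanonicalHeightFor

variable {h ĥ : G → ℝ}

/-- A canonical height vanishes on torsion points. Silverman, AEC VIII.9.3(d) (easy direction);
Hindry–Silverman B.5.3. [folklore] -/
theorem eq_zero_of_isOfFinAddOrder (hc : IsCanonicalHeightFor h ĥ) {P : G}
    (hP : IsOfFinAddOrder P) : ĥ P = 0 := by
  obtain ⟨n, hn, hnP⟩ := hP.exists_nsmul_eq_zero
  have := hc.map_nsmul n P
  rw [hnP, hc.map_zero] at this
  have hn' : (n : ℝ) ^ 2 ≠ 0 := by positivity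
  exact (mul_eq_zero.mp this.symm).resolve_left hn'

/-- A canonical height for a naive height that is bounded below is nonnegative.
Silverman, AEC VIII.9.3(c); Hindry–Silverman B.5.1. [folklore] -/
theorem nonneg (hc : IsCanonicalHeightFor h ĥ) (hb : BddBelow (Set.range h)) (P : G) :
    0 ≤ ĥ P := by
  obtain ⟨b, hb⟩ := hb
  have hlim : Tendsto (fun n : ℕ ↦ b / (4 : ℝ) ^ n) atTop (𝓝 0) := by
    simpa [div_eq_mul_inv] using (tendsto_pow_atTop_nhds_zero_of_lt_one (r := (4 : ℝ)⁻¹)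
      (by norm_num) (by norm_num)).const_mul b
  refine le_of_tendsto_of_tendsto' hlim (hc.tendsto P) fun n ↦ ?_
  gcongr
  exact hb ⟨_, rfl⟩

/-- Northcott property of the canonical height: if `h` is Northcott then so is `ĥ`, i.e.
`{P | ĥ P ≤ B}` is finite for every `B`. Silverman, AEC VIII.9.3 (with VIII.6.7);
Hindry–Silverman B.5.3. [folklore] -/
theorem finite_setOf_le (hc : IsCanonicalHeightFor h ĥ) [Northcott h] (B : ℝ) :
    {P : G | ĥ P ≤ B}.Finite := by
  obtain ⟨C, hC⟩ := hc.isBounded_sub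
  refine (Northcott.finite_le (h := h) (B + C)).subset fun P hP ↦ ?_
  have := (abs_le.mp (hC P)).1
  simp only [Set.mem_setOf_eq] at hP ⊢
  linarith

/-- For a Northcott naive height bounded below, the canonical height vanishes exactly on the
torsion subgroup. Silverman, AEC VIII.9.3(d); Hindry–Silverman B.5.3. [cite: SilvermanAEC2009, Theorem VIII.9.3(d)] -/
def eq_zero_iff_isOfFinAddOrder : Prop :=
  ∀ (hc : IsCanonicalHeightFor h ĥ) [Northcott h] (hb : BddBelow (Set.range h)) {P : G},
    ĥ P = 0 ↔ IsOfFinAddOrder P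

/-- Discharge of `eq_zero_iff_isOfFinAddOrder`: for a Northcott naive height, a canonical height
vanishes exactly on torsion. `←` is `eq_zero_of_isOfFinAddOrder`; for `→`, if `ĥ P = 0` then
`ĥ (n • P) = n² ĥ P = 0` for all `n : ℕ`, so `n ↦ n • P` maps `ℕ` into the finite set
`{Q | ĥ Q ≤ 0}` (`finite_setOf_le`), hence is not injective and `P` has finite order — the printed
argument of Silverman, with (VIII.6.1) replaced by the `Northcott h` hypothesis. (The bounded-below
hypothesis `hb` of the fact is not needed.)
[cite: SilvermanAEC2009, Theorem VIII.9.3(d), pp. 248–249] -/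
theorem eq_zero_iff_isOfFinAddOrder_holds : eq_zero_iff_isOfFinAddOrder (h := h) (ĥ := ĥ) := by
  intro hc _ _ P
  refine ⟨fun hP ↦ ?_, hc.eq_zero_of_isOfFinAddOrder⟩
  by_contra hfin
  have hinj : Function.Injective fun n : ℕ ↦ n • P :=
    injective_nsmul_iff_not_isOfFinAddOrder.mpr hfin
  have hsub : Set.range (fun n : ℕ ↦ n • P) ⊆ {Q : G | ĥ Q ≤ 0} := by
    rintro _ ⟨n, rfl⟩
    simp [hc.map_nsmul, hP]
  exact Set.infinite_range_of_injective hinj ((hc.finite_setOf_le 0).subset hsub)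

end IsCanonicalHeightFor

/-- The Néron–Tate pairing recovers the height on the diagonal: `⟨P, P⟩ = ĥ P`.
Silverman, AEC VIII.9.3. [folklore] -/
theorem neronTatePairing_self {h ĥ : G → ℝ} (hc : IsCanonicalHeightFor h ĥ) (P : G) :
    neronTatePairing ĥ P P = ĥ P := by
  have := hc.map_nsmul 2 P
  rw [two_nsmul] at this
  simp only [neronTatePairing, this]
  push_cast
  ring

/-- The Néron–Tate pairing of a canonical height is additive in the first variable (hence
bilinear, by symmetry). Silverman, AEC VIII.9.3(e); Hindry–Silverman B.5.1. [cite: SilvermanAEC2009, Theorem VIII.9.3(e)] -/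
def IsCanonicalHeightFor.neronTatePairing_add_left : Prop :=
  ∀ {h ĥ : G → ℝ} (hc : IsCanonicalHeightFor h ĥ) (P Q R : G),
    neronTatePairing ĥ (P + Q) R = neronTatePairing ĥ P R + neronTatePairing ĥ Q R

/-- The Néron–Tate pairing is symmetric. Silverman, AEC VIII.9.3. [folklore] -/
theorem neronTatePairing_comm (ĥ : G → ℝ) (P Q : G) :
    neronTatePairing ĥ P Q = neronTatePairing ĥ Q P := by
  simp only [neronTatePairing, add_comm P Q]
  ring

end Literature.NumberTheory.DiophantineGeometry
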